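import Literature.AnabelianGeometry.EtaleTheta.Discharge.Sec2Cor218ivTrivialBaseSharp
import Literature.AnabelianGeometry.EtaleTheta.Discharge.Sec2IsoLift
import HarnessLib

/-!
# [EtTh] Cor. 2.18 (iv), fibres, for `ThetaEnvData` with `G_K = 1`: what the clause `D_Y ↦ D_Y` of an
# isomorphism of mono-theta environments imposes, and the resulting rigidity criterion (proof-only)

S. Mochizuki, *The Étale Theta Function …* [EtTh], Publ. RIMS **45** (2009), §2, Def. 2.13 (i)–(ii) p. 47,
Cor. 2.18 (iv) pp. 61–63, and the MECHANISM of Prop. 2.14 (i) p. 49 ("`γ(β)·β⁻¹`": the `Gal(Y/X)`-part of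
`D_Y` is what rigidifies the cyclotome) (locators `p.N` = PDF pages; bib key `MochizukiEtTh2009`).

PROOF-ONLY sequel (no `def`, no instance, no new named fact) of `Sec2Cor218ivTrivialBaseSharp.lean`
(same seat).  With `G_K = 1`, a model automorphism `α` over `id_{Π^tp_Y}` has the shape
`(u, y) ↦ (ψ u · f(y), y)` (`ψ ∈ Aut(μ_N)`, `f ∈ Hom(Π^tp_Y, μ_N)`, `f|_{Π^tp_Ÿ} = (ψ ∘ η) · η⁻¹`).  The
sharp criterion `cor218_iv_fibre_of_coeff_rigid` ignores the clause `D_Y ↦ D_Y` of Def. 2.13 (ii); here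
that clause is cashed in:

* `left_eq_of_mk_mem_DY` — with `G_K = 1`, every representative of an element of
  `D_Y ⊆ Out(Π^tp_Y[μ_N])` acts TRIVIALLY on the `μ_N`-coordinate (the Kummer generators are trivial, the
  `Gal(Y/X)`-generators `conj_x` act on `μ_N` through the trivial character, inner automorphisms act
  trivially since `μ_N` is central);
* `iso_left_algSection_conj` — hence `α ∘ conj_x ∘ α⁻¹`, a representative of an element of `D_Y` by the
  clause `D_Y ↦ D_Y`, acts trivially on `μ_N`-coordinates, which unwinds to the `Π^tp_X`-CONJUGATION
  INVARIANCE `f(x y x⁻¹) = f(y)` of the homomorphism part `f`;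
* `cor218_iv_fibre_of_coeff_rigid_conj` — **the rigidity criterion with conjugation invariance**: if the
  only `ψ ∈ Aut(μ_N)` for which `(ψ ∘ η) · η⁻¹` extends to a `Π^tp_X`-conjugation-invariant homomorphism
  on `Π^tp_Y` is `ψ = id`, the fibre clause `Cor218_iv_fibre` holds (with `c = 1`).

This is the criterion met by toys with ABELIAN `Π^tp_Y` but non-trivial `Gal(Y/X)`-action (the discrete
Heisenberg skeleton of `(Π^tp_X)^Θ`: `f` must kill `[Π^tp_X, Π^tp_Y] ∋` the generator of `l·Δ_Θ`), where
`cor218_iv_fibre_of_coeff_rigid` does not apply.  HONEST FRAMING: statements about the cell's own typing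
over an abstract interface; nothing here bears on [EtTh] (refereed) or on [IUTchIII] Cor. 3.12; no side
taken; typed ≠ proved.  Cell `abc-iut`, seat abc-iut-f-151 (tranche 151).
-/

namespace Literature.AnabelianGeometry.EtaleTheta

universe u

namespace ThetaEnvData

variable {N : ℕ+} (T : ThetaEnvData.{u} N)

section SubsingletonG

variable [Subsingleton T.G]

/-- **With `G_K = 1`, `D_Y` acts trivially on the `μ_N`-coordinate**: every representative `φ` of an
element of `D_Y` satisfies `(φ x)_μ = x_μ`. [cite: MochizukiEtTh2009, Def 2.13(i) p.47] -/
theorem left_eq_of_mk_mem_DY (φ : contMulAut T.env) (hφ : TopOut.mk _ φ ∈ T.DY) (x : T.env) :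
    ((φ : MulAut T.env) x).left = x.left := by
  -- inner automorphisms act trivially on the `μ`-coordinate
  have hinner : ∀ {φ ψ : contMulAut T.env}, TopOut.mk _ φ = TopOut.mk _ ψ →
      (∀ x : T.env, ((ψ : MulAut T.env) x).left = x.left) →
      ∀ x : T.env, ((φ : MulAut T.env) x).left = x.left := by
    intro φ ψ h hψ x
    obtain ⟨z, hz, hzeq⟩ := (QuotientGroup.mk'_eq_mk' _).mp h.symm
    obtain ⟨y, hy⟩ := MonoidHom.mem_range.mp (Subgroup.mem_subgroupOf.mp hz)
    have : (φ : MulAut T.env) x = (ψ : MulAut T.env) (y * x * y⁻¹) := by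
      rw [← hzeq, Subgroup.coe_mul, MulAut.mul_apply, ← hy, MulAut.conj_apply]
    rw [this, hψ, T.mul_left_eq, T.mul_left_eq, T.inv_left_eq, mul_inv_cancel_comm]
  have key : ∀ d ∈ T.DY, ∀ φ : contMulAut T.env, TopOut.mk _ φ = d →
      ∀ x : T.env, ((φ : MulAut T.env) x).left = x.left := by
    intro d hd
    refine Subgroup.closure_induction (p := fun d _ => ∀ φ : contMulAut T.env,
      TopOut.mk _ φ = d → ∀ x : T.env, ((φ : MulAut T.env) x).left = x.left) ?_ ?_ ?_ ?_ hd
    · rintro d (⟨δ, hδ, hc, rfl⟩ | ⟨g, hc, rfl⟩) φ hφd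
      · refine hinner hφd fun x => ?_
        change (CycEnvelope.shift hδ x).left = x.left
        rw [T.shift_inflated_eq_one hδ]
        rfl
      · refine hinner hφd fun x => ?_
        change T.chi (T.aug g) x.left = x.left
        rw [Subsingleton.elim (T.aug g) 1, map_one, MulAut.one_apply]
    · intro φ hφ
      exact hinner (ψ := 1) (by simpa using hφ) fun x => rfl
    · intro d₁ d₂ _ _ h₁ h₂ φ hφ
      obtain ⟨φ₁, rfl⟩ := QuotientGroup.mk'_surjective _ d₁
      have hg₁ := h₁ φ₁ rfl
      have hg₂ := h₂ (φ₁⁻¹ * φ) (by rw [map_mul, map_inv, hφ, inv_mul_cancel_left])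
      intro x
      have : (φ : MulAut T.env) x = (φ₁ : MulAut T.env) (((φ₁⁻¹ * φ : contMulAut T.env) :
          MulAut T.env) x) := by
        rw [Subgroup.coe_mul, Subgroup.coe_inv, MulAut.mul_apply, MulAut.apply_inv_self]
      rw [this, hg₁, hg₂]
    · intro d _ h φ hφ x
      have hg := h φ⁻¹ (by rw [map_inv, hφ, inv_inv])
      have hx := hg ((φ : MulAut T.env) x)
      rw [Subgroup.coe_inv, MulAut.inv_apply_self] at hx
      exact hx.symm
  exact key _ hφ φ rfl x

/-- **The clause `D_Y ↦ D_Y` forces conjugation invariance of the homomorphism part** (`G_K = 1`): for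
ANY automorphism `α` of the model `M(η)` and any `g ∈ Π^tp_X`, `y ∈ Π^tp_Y`,
`(α s^alg(g y g⁻¹))_μ = (α s^alg(y))_μ` — since `α ∘ conj_g ∘ α⁻¹` represents an element of `D_Y`.
[cite: MochizukiEtTh2009, Prop 2.14(i) p.49] -/
theorem iso_left_algSection_conj {η : T.PiYdd → T.mu} (hη : η ∈ T.thetaCocycles)
    (α : (T.modelMono hη).Iso (T.modelMono hη)) (g : T.PiX) (y : T.PiY) :
    (α.e (CycEnvelope.algSection T.augY T.chi ⟨g * (y : T.PiX) * g⁻¹, T.PiY_normal.conj_mem _ y.2 g⟩)).left =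
      (α.e (CycEnvelope.algSection T.augY T.chi y)).left := by
  -- `[α ∘ conj_g ∘ α⁻¹] ∈ D_Y`
  have hmem : TopOut.transport α.e (TopOut.mk _ ⟨T.conjX g, T.conjX_mem_contMulAut g⟩) ∈ T.DY := by
    have h := α.map_D
    change T.DY.map (TopOut.transport α.e) = T.DY at h
    rw [← h]
    exact ⟨_, T.mk_conjX_mem_DY g, rfl⟩
  rw [transport_mk] at hmem
  have key := T.left_eq_of_mk_mem_DY _ hmem (α.e (CycEnvelope.algSection T.augY T.chi y))
  rw [conjContAut_apply, ContinuousMulEquiv.symm_apply_apply] at key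
  -- `conj_g (s^alg y) = s^alg (g y g⁻¹)` (the character is trivial)
  have hconj : T.conjX g (CycEnvelope.algSection T.augY T.chi y) =
      CycEnvelope.algSection T.augY T.chi ⟨g * (y : T.PiX) * g⁻¹, T.PiY_normal.conj_mem _ y.2 g⟩ := by
    refine SemidirectProduct.ext ?_ (Subtype.ext rfl)
    change T.chi (T.aug g) (CycEnvelope.algSection T.augY T.chi y).left = _
    rw [SemidirectProduct.left_inr, map_one, SemidirectProduct.left_inr]
  rw [hconj] at key
  exact key

/-- **Cor. 2.18 (iv), fibres — rigidity criterion WITH conjugation invariance** (`G_K = 1`): if the only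
coefficient automorphism `ψ ∈ Aut(μ_N)` for which `(ψ ∘ η) · η⁻¹` extends from `Π^tp_Ÿ` to a homomorphism
`f : Π^tp_Y → μ_N` INVARIANT UNDER `Π^tp_X`-CONJUGATION is `ψ = id`, then every model automorphism over
`id_{Π^tp_Y}` is the twist by a homomorphism killing `Π^tp_Ÿ`: `Cor218_iv_fibre` holds (with `c = 1`).
The invariance premise is supplied by the clause `D_Y ↦ D_Y` (`iso_left_algSection_conj`).
[cite: MochizukiEtTh2009, Cor 2.18(iv) p.63] -/
theorem cor218_iv_fibre_of_coeff_rigid_conj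
    (hrig : ∀ (η : T.PiYdd → T.mu), η ∈ T.thetaCocycles → ∀ (ψ : T.mu ≃* T.mu) (f : T.PiY →* T.mu),
      (∀ y : T.PiYdd, f (T.inclYdd y) = ψ (η y) * (η y)⁻¹) →
      (∀ (g : T.PiX) (y : T.PiY), f ⟨g * (y : T.PiX) * g⁻¹, T.PiY_normal.conj_mem _ y.2 g⟩ = f y) →
      ψ = MulEquiv.refl T.mu) :
    Literature.AnabelianGeometry.EtaleTheta.ThetaEnvData.Cor218_iv_fibre T := by
  classical
  intro η hη
  refine ⟨fun α hα => ?_, fun φ hφ => T.exists_iso_eq_twist hη φ hφ⟩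
  let A : MulAut T.env := α.e.toMulEquiv
  have hAe : ∀ x, α.e x = A x := fun x => rfl
  have hAright : ∀ x, (A x).right = x.right := hα
  -- the homomorphism part `f : y ↦ (A s^alg(y))_μ`
  let sY : T.PiY →* T.env := CycEnvelope.algSection T.augY T.chi
  let f : T.PiY →* T.mu := MonoidHom.mk' (fun y => (A (sY y)).left) (fun y y' => by
    change (A (sY (y * y'))).left = (A (sY y)).left * (A (sY y')).left
    rw [map_mul, map_mul, mul_left_eq])
  have hAsY : ∀ y, A (sY y) = ⟨f y, y⟩ := fun y =>
    SemidirectProduct.ext rfl (by rw [hAright]; rfl)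
  -- the coefficient part `ψ : a ↦ (A a)_μ`, an automorphism of the (finite) cyclotome
  let ψh : T.mu →* T.mu := MonoidHom.mk' (fun a => (A (CycEnvelope.inMu T.augY T.chi a)).left)
    (fun a b => by rw [map_mul, map_mul, mul_left_eq])
  have hAμ : ∀ a, A (CycEnvelope.inMu T.augY T.chi a) = CycEnvelope.inMu T.augY T.chi (ψh a) :=
    fun a => T.apply_inMu_eq_of_over_id A hAright a
  have hψinj : Function.Injective ψh := by
    intro a b hab
    have h1 : A (CycEnvelope.inMu T.augY T.chi a) = A (CycEnvelope.inMu T.augY T.chi b) := by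
      rw [hAμ, hAμ]
      exact congrArg _ hab
    exact SemidirectProduct.inl_injective (A.injective h1)
  let ψ : T.mu ≃* T.mu :=
    MulEquiv.ofBijective ψh ⟨hψinj, Finite.injective_iff_surjective.mp hψinj⟩
  -- on `Π^tp_Ÿ`: `f = (ψ ∘ η) · η⁻¹`, since `A` fixes `s^Θ` pointwise
  have hfdd : ∀ y : T.PiYdd, f (T.inclYdd y) = ψ (η y) * (η y)⁻¹ := by
    intro y
    have h1 : sY (T.inclYdd y) = CycEnvelope.inMu T.augY T.chi (η y) * T.sTheta hη y := by
      ext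
      · simp [sY, ThetaEnvData.sTheta]
      · simp [sY, ThetaEnvData.sTheta]
    have h2 : A (sY (T.inclYdd y)) =
        CycEnvelope.inMu T.augY T.chi (ψh (η y)) * T.sTheta hη y := by
      rw [h1, map_mul, hAμ, ← hAe (T.sTheta hη y), T.iso_apply_sTheta_of_over_id hη α hα y]
    have h3 := congrArg SemidirectProduct.left h2
    rw [hAsY, mul_left_eq, SemidirectProduct.left_inl] at h3
    exact h3
  -- `f` is conjugation invariant, by `D_Y ↦ D_Y`
  have hfinv : ∀ (g : T.PiX) (y : T.PiY),
      f ⟨g * (y : T.PiX) * g⁻¹, T.PiY_normal.conj_mem _ y.2 g⟩ = f y :=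
    fun g y => T.iso_left_algSection_conj hη α g y
  have hψ1 : ψ = MulEquiv.refl T.mu := hrig η hη ψ f hfdd hfinv
  have hψid : ∀ a, ψh a = a := fun a => by
    change ψ a = a
    rw [hψ1]
    rfl
  -- conclusion: `α = twist by f`, `c = 1`
  have hfkill : ∀ y : T.PiYdd, f (T.inclYdd y) = 1 := fun y => by
    rw [hfdd y]
    change ψh (η y) * (η y)⁻¹ = 1
    rw [hψid, mul_inv_cancel]
  refine ⟨f, hfkill, 1, fun x => ?_⟩
  rw [hAe, map_one, map_one, MulAut.one_apply]
  calc A x = A (CycEnvelope.inMu T.augY T.chi x.left * sY x.right) := by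
        rw [CycEnvelope.inMu_mul_algSection]
    _ = CycEnvelope.inMu T.augY T.chi x.left * ⟨f x.right, x.right⟩ := by
        rw [map_mul, hAμ, hψid, hAsY]
    _ = CycEnvelope.inMu T.augY T.chi (f (CycEnvelope.proj T.augY T.chi x)) * x := by
        refine SemidirectProduct.ext ?_ ?_
        · rw [mul_left_eq, mul_left_eq, SemidirectProduct.left_inl, SemidirectProduct.left_inl]
          exact mul_comm _ _
        · simp

end SubsingletonG

end ThetaEnvData

end Literature.AnabelianGeometry.EtaleTheta
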